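import Summits.NavierStokesRegularity.Statement
import Literature.Analysis.FluidPDE.NSVorticity
import Literature.Analysis.FluidPDE.LerayHopf

/-!
# NavierStokesRegularity / VorticityGeometry — assembly (corrected form)

Route `NavierStokesRegularity/VorticityGeometry`, item `stmt-NavierStokesRegularity-0092` (assembly).
As filed the item is the bare implication `X → NoBlowup` (X = a-priori Constantin–Fefferman
direction coherence, `stmt-NavierStokesRegularity-0091`), which silently requires the
Constantin–Fefferman theorem and BKM-class persistence. This file proves the corrected form with
both prepended as hypotheses: the named fact `Literature.Analysis.FluidPDE.constantin_fefferman` (Constantin–Fefferman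
1993) and the persistence crux `stmt-NavierStokesRegularity-0094`. The proof is bookkeeping:
X supplies `(Ω, ρ)`, persistence supplies the BKM-class hypothesis, Constantin–Fefferman gives a
Sobolev extension past `T`, hence a smooth one.
-/

namespace Literature.NS

/-- Corrected assembly of route VorticityGeometry (for `stmt-NavierStokesRegularity-0092`):
Constantin–Fefferman (fact) → BKM-class persistence (crux 0094) → a-priori direction coherence
(thesis 0091) → no blow-up for finite-energy classical solutions from Clay data. [folklore] -/
theorem vorticityGeometry_assembly :
    Literature.Analysis.FluidPDE.constantin_fefferman →
    (∀ (ν T : ℝ), 0 < ν → 0 < T → ∀ (u : ℝ → EuclideanSpace ℝ (Fin 3) → EuclideanSpace ℝ (Fin 3)) (p : ℝ → EuclideanSpace ℝ (Fin 3) → ℝ), Literature.Analysis.FluidPDE.IsClassicalNSSolutionOn (Set.Ico 0 T) ν 0 u p → Literature.Analysis.FluidPDE.IsLerayHopfOn T ν 0 (u 0) u → Literature.Analysis.FluidPDE.HasRapidSpatialDecay (u 0) → ∀ T'' < T, Literature.Analysis.FluidPDE.HasBoundedSobolevNormsOn (Set.Icc 0 T'') u) →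
    (∀ (ν T : ℝ), 0 < ν → 0 < T → ∀ (u : ℝ → EuclideanSpace ℝ (Fin 3) → EuclideanSpace ℝ (Fin 3)) (p : ℝ → EuclideanSpace ℝ (Fin 3) → ℝ), Literature.Analysis.FluidPDE.IsClassicalNSSolutionOn (Set.Ico 0 T) ν 0 u p → Literature.Analysis.FluidPDE.IsLerayHopfOn T ν 0 (u 0) u → Literature.Analysis.FluidPDE.HasRapidSpatialDecay (u 0) → ∃ Ω ρ : ℝ, 0 < Ω ∧ 0 < ρ ∧ ∀ t ∈ Set.Ico 0 T, ∀ x y : EuclideanSpace ℝ (Fin 3), Ω < ‖Literature.Analysis.FluidPDE.curl (u t) x‖ → Ω < ‖Literature.Analysis.FluidPDE.curl (u t) y‖ → Real.sqrt (1 - (inner ℝ (Literature.Analysis.FluidPDE.vorticityDirection (Literature.Analysis.FluidPDE.curl (u t)) x) (Literature.Analysis.FluidPDE.vorticityDirection (Literature.Analysis.FluidPDE.curl (u t)) y)) ^ 2) ≤ ‖x - y‖ / ρ) →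
    ∀ (ν T : ℝ), 0 < ν → 0 < T → ∀ (u : ℝ → EuclideanSpace ℝ (Fin 3) → EuclideanSpace ℝ (Fin 3)) (p : ℝ → EuclideanSpace ℝ (Fin 3) → ℝ), Literature.Analysis.FluidPDE.IsClassicalNSSolutionOn (Set.Ico 0 T) ν 0 u p → Literature.Analysis.FluidPDE.IsLerayHopfOn T ν 0 (u 0) u → Literature.Analysis.FluidPDE.HasRapidSpatialDecay (u 0) → Literature.Analysis.FluidPDE.HasSmoothExtensionPast ν 0 u T := by
  intro hCF h4 hX ν T hν hT u p hsol hlh hdec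
  obtain ⟨Ω, ρ, hΩ, hρ, hdir⟩ := hX ν T hν hT u p hsol hlh hdec
  exact (hCF hν hT hΩ hρ hsol (h4 ν T hν hT u p hsol hlh hdec) hdir).hasSmoothExtensionPast

/-- Settles `stmt-NavierStokesRegularity-0092` (re-signed corrected form, verbatim): Constantin–Fefferman
(fact) → BKM-class persistence (crux 0094) → a-priori direction coherence X (thesis 0091) → no blow-up.
Identical to `vorticityGeometry_assembly`; restated with the item's exact signature so the gate closes it. [folklore] -/
theorem vorticityGeometry_assembly_v2 :
    Literature.Analysis.FluidPDE.constantin_fefferman → (∀ (ν T : ℝ), 0 < ν → 0 < T → ∀ (u : ℝ → EuclideanSpace ℝ (Fin 3) → EuclideanSpace ℝ (Fin 3)) (p : ℝ → EuclideanSpace ℝ (Fin 3) → ℝ), Literature.Analysis.FluidPDE.IsClassicalNSSolutionOn (Set.Ico 0 T) ν 0 u p → Literature.Analysis.FluidPDE.IsLerayHopfOn T ν 0 (u 0) u → Literature.Analysis.FluidPDE.HasRapidSpatialDecay (u 0) → ∀ T'' < T, Literature.Analysis.FluidPDE.HasBoundedSobolevNormsOn (Set.Icc 0 T'') u) → (∀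 (ν T : ℝ), 0 < ν → 0 < T → ∀ (u : ℝ → EuclideanSpace ℝ (Fin 3) → EuclideanSpace ℝ (Fin 3)) (p : ℝ → EuclideanSpace ℝ (Fin 3) → ℝ), Literature.Analysis.FluidPDE.IsClassicalNSSolutionOn (Set.Ico 0 T) ν 0 u p → Literature.Analysis.FluidPDE.IsLerayHopfOn T ν 0 (u 0) u → Literature.Analysis.FluidPDE.HasRapidSpatialDecay (u 0) → ∃ Ω ρ : ℝ, 0 < Ω ∧ 0 < ρ ∧ ∀ t ∈ Set.Ico 0 T, ∀ x y : EuclideanSpace ℝ (Fin 3), Ω < ‖Literature.Analysis.FluidPDE.curl (u t) x‖ → Ω < ‖Literature.Analysis.FluidPDE.curl (u t) y‖ → Real.sqrt (1 - (inner ℝ (Literature.Analysis.FluidPDE.vorticityDirection (Literature.Analysis.FluidPDE.curl (u t)) x) (Literature.Analysis.FluidPDE.vorticityDirection (Literature.Analysis.FluidPDE.curl (u t)) y)) ^ 2) ≤ ‖x - y‖ / ρ) → ∀ (ν T : ℝ), 0 < ν → 0 < T → ∀ (u : ℝ → EuclideanSpace ℝ (Fin 3) → EuclideanSpace ℝ (Fin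 3)) (p : ℝ → EuclideanSpace ℝ (Fin 3) → ℝ), Literature.Analysis.FluidPDE.IsClassicalNSSolutionOn (Set.Ico 0 T) ν 0 u p → Literature.Analysis.FluidPDE.IsLerayHopfOn T ν 0 (u 0) u → Literature.Analysis.FluidPDE.HasRapidSpatialDecay (u 0) → Literature.Analysis.FluidPDE.HasSmoothExtensionPast ν 0 u T :=
  vorticityGeometry_assembly

end Literature.NS
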